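import Summits.CriticalPhenomena.CardyFormulaZ2.Theorems.CardyComplexConeParafermionToSLESixFamiliesDiamondDefs
import Literature.Analysis.Complex.DarbouxPicard
import HarnessLib

/-!
# Stub S2 `stub_argumentPrinciple` of line `potential-darboux-picard-diamond` (crux `ParafermionToSLESixFamilies`)

Route `CardyComplexCone`, sub-problem `CriticalPhenomena/CardyFormulaZ2`, crux item stmt-CriticalPhenomena-11389
(`Summit.CriticalPhenomena.CardyFormulaZ2.Theses.CardyComplexCone.ParafermionToSLESixFamilies`), line
`potential-darboux-picard-diamond`, lead `prover-line-stmt-CriticalPhenomena-11389-c5-0`. This file proves the registered stub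

  `theorem stub_argumentPrinciple : DarbouxPicardConvex ∧ TraceWindingNonneg`

of the checked skeleton `Cruxes/ParafermionToSLESixFamilies/Lines/potential_darboux_picard_diamond.lean` BY NAME AND
SIGNATURE (`DarbouxPicardConvex`, `TraceWindingNonneg` are the typed statements of the landed definitions module
`…DiamondDefs.lean`, p137545): the IDENTIFICATION ENGINE of the line — Darboux's theorem for a convex target (a map
holomorphic on the unit disc and continuous on the closed disc whose boundary values lie on `frontier K`, `K` compact
convex, and wind once about an interior point `w₀` is injective on the disc and maps it onto `interior K`) and its
companion (a continuous argument of a holomorphic boundary trace about an omitted point never decreases over `[0, 2π]`).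

Both are pure classical complex analysis and are proved in full generality in the Literature file
`Literature/Analysis/Complex/DarbouxPicard.lean` (`Literature.Analysis.Complex.darbouxPicard_convex`,
`Literature.Analysis.Complex.traceWinding_nonneg`; argument principle on the circles `‖z‖ = r → 1` in the winding-number
language of `Literature.Topology.PlaneTopology.wind` — `ArgumentPrincipleWinding.lean` —, constancy of the winding
number on complementary components, and the open mapping theorem); the Literature form of Darboux's theorem does not even
use the monotonicity of the argument `θ`, only `θ(2π) = θ(0) + 2π`. This file is the 2-line specialisation.
-/

noncomputable section

namespace Summit.CriticalPhenomena.CardyFormulaZ2.Cruxes.ParafermionToSLESixFamilies.PotentialDarbouxPicardDiamond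

open Set Metric Complex

/-- **S2** `stub_argumentPrinciple`: Darboux–Picard univalence for a convex target (`DarbouxPicardConvex`: `Φ`
holomorphic on `ball 0 1`, continuous on `closedBall 0 1`, boundary values on `frontier K` for `K` compact convex with a
continuous argument about `w₀ ∈ interior K` increasing by `2π` over `[0, 2π]` ⇒ `InjOn Φ (ball 0 1)` and
`Φ '' ball 0 1 = interior K`) and its companion `TraceWindingNonneg` (a continuous argument of `Φ(e^{it}) - w₀` along
the circle satisfies `θ 0 ≤ θ (2π)`). Both by `Literature.Analysis.Complex.darbouxPicard_convex` /
`Literature.Analysis.Complex.traceWinding_nonneg` (Darboux's theorem, Boas *Invitation to Complex Analysis* §13D; argument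
principle, Conway Ch. V Thm 3.4). -/
theorem stub_argumentPrinciple : DarbouxPicardConvex ∧ TraceWindingNonneg :=
  ⟨fun Φ K w₀ θ hK hKc hw₀ hd hc _ hθc h2π hb =>
      Literature.Analysis.Complex.darbouxPicard_convex Φ K w₀ θ hK hKc hw₀ hd hc hθc h2π hb,
    fun Φ w₀ θ hd hc hθ hb => Literature.Analysis.Complex.traceWinding_nonneg Φ w₀ θ hd hc hθ hb⟩

end Summit.CriticalPhenomena.CardyFormulaZ2.Cruxes.ParafermionToSLESixFamilies.PotentialDarbouxPicardDiamond

end
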